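import Mathlib
import HarnessLib
import Summits.ResolutionOfSingularities.ResolutionOfSingularities.Theses.WildQuotients
import Summits.ResolutionOfSingularities.ResolutionOfSingularities.Theorems.WildQuotientsWildQuotientResolutionStubQuotientModel
import Summits.ResolutionOfSingularities.ResolutionOfSingularities.Theorems.WildQuotientsWildQuotientResolutionStubBirational
import Literature.AlgebraicGeometry.Ramification.InertiaNormalSylow
import Literature.AlgebraicGeometry.Resolution.ResolutionOfSingularities
import Literature.AlgebraicGeometry.Resolution.ComponentGluing
import Literature.AlgebraicGeometry.Resolution.AlterationsProofs
import Literature.AlgebraicGeometry.Resolution.AlterationsDimension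

/-!
# The glued split of `WildQuotientResolution` in BOUNDED DIMENSION — proved glue (crux stmt-ResolutionOfSingularities-15640, line `Sketch`)

The line `Sketch` reduces the crux `WildQuotients.WildQuotientResolution` (WQ) to its two open
sub-problems PhaseZeroModel (`stub_phaseZero`) and PClosedWQ (`stub_pClosedWQ`) with ALL glue
proved (`GluedSplit.wildQuotientResolution_of_phaseZero_of_pClosedWQ`, p138408). WQ is open from
dimension `4`, PhaseZeroModel is within known technology up to `dim X′ ≤ 4` (line card,
Addendum 1 of cycle 2: the centres `Fix(R)_red` have dimension `≤ 2` there) and open-adjacent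
from dimension `5`–`6`; the line card therefore recommends a DIMENSION-BOUNDED companion target
("WQ for `dim X₁ ≤ d`", first interesting value `d = 4`). This file proves the glue of that
companion, so that a planner can file `WQ_{≤ d} ⇐ PhaseZeroModel_{≤ d} ∧ PClosedWQ_{≤ d}` as a
glued split whose glue is already a theorem:

* `topologicalKrullDim_eq_of_isBirational` — a birational morphism locally of finite type between
  integral schemes, the target locally of finite type over a field, preserves the dimension
  (both contain a common non-empty open; Görtz–Wedhorn I 5.22 (3)).
* `wildQuotientResolution_dimLE_of_phaseZero_of_pClosedWQ` — for every bound `d`: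
  PhaseZeroModel for faithful actions on regular `X′` with `dim X′ ≤ d`, and PClosedWQ for
  quotient data with `dim X₁ ≤ d`, imply WQ for quotient data with `dim X₁ ≤ d`. The dimension
  bookkeeping: `dim X′ = dim X₁` (`q` finite surjective, Stacks 0ECG), `dim X♯ = dim X′`
  (`π` proper birational), `dim (X♯/G) = dim X♯` (`q♯` finite surjective).

Everything else is the dimension-free composition verbatim (faithful WLOG by passing to
`G ⧸ ker ρ`, `QuotientModel.stub_quotientModel`, lemma (L)
`Birational.stub_birational_of_bijective`, dimension `0`, descent along `X♯/G → X₁`).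
-/

-- single-problem summit: the doubled namespace component `ResolutionOfSingularities` is forced
set_option linter.dupNamespace false

noncomputable section

open CategoryTheory AlgebraicGeometry TopologicalSpace
open Literature.AlgebraicGeometry.Resolution Literature.AlgebraicGeometry.Ramification
open Summit.ResolutionOfSingularities.ResolutionOfSingularities.Theses.WildQuotients

namespace Summit.ResolutionOfSingularities.ResolutionOfSingularities.Theorems.WildQuotientResolution.GluedSplitDim

/-- **Proper birational morphisms preserve dimension**: if `π : X♯ → X′` is birational between
integral schemes, `π` locally of finite type and `X′` locally of finite type over a field `k`,
then `dim X♯ = dim X′` — over the dense open `U` of birationality, `π⁻¹(U) ≅ U` is a non-empty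
open of both. [cite: GortzWedhorn2020, Thm. 5.22 (3)] -/
theorem topologicalKrullDim_eq_of_isBirational {k : Type} [Field k] {Xs X' : Scheme.{0}}
    [IsIntegral Xs] [IsIntegral X'] (f' : X' ⟶ Spec (.of k)) [LocallyOfFiniteType f']
    (π : Xs ⟶ X') [LocallyOfFiniteType π] (hbir : IsBirational π) :
    topologicalKrullDim Xs = topologicalKrullDim X' := by
  obtain ⟨U, hUd, hUd', hUiso⟩ := hbir
  haveI := hUiso
  have hne : ((π ⁻¹ᵁ U : Xs.Opens) : Set Xs).Nonempty := hUd'.nonempty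
  haveI : Nonempty (π ⁻¹ᵁ U : Xs.Opens) := hne.to_subtype
  -- `π⁻¹(U) ≅ U ↪ X′` is an open immersion
  haveI : IsOpenImmersion ((π ∣_ U) ≫ U.ι) := inferInstance
  calc topologicalKrullDim Xs = topologicalKrullDim (π ⁻¹ᵁ U : Xs.Opens) :=
        (topologicalKrullDim_opens_eq (π ≫ f') (π ⁻¹ᵁ U) hne).symm
    _ = topologicalKrullDim X' := topologicalKrullDim_eq_of_isOpenImmersion f' ((π ∣_ U) ≫ U.ι)

/-- **The glued split of the crux in bounded dimension, proved.** For any bound `d`: if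
(PhaseZeroModel_{≤ d}) every FAITHFUL action of a finite group on a regular integral `X′` of
dimension `≤ d`, finite and invariant over a separated finite-type `X₁/k`, admits an equivariant
proper birational regular integral model with p-closed inertia groups and a stable affine cover,
and (PClosedWQ_{≤ d}) the crux holds for quotient data with p-closed inertia and `dim X₁ ≤ d`,
then the crux holds for all quotient data with `dim X₁ ≤ d`. Proof: the dimension-free
composition of line `Sketch` (faithful WLOG via `G ⧸ ker ρ`; Phase 0; dimension `0`; quotient
`X♯/G → X₁` by `QuotientModel.stub_quotientModel`; birational by lemma (L); PClosedWQ; descent),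
with `dim X′ = dim X₁` (finite surjective `q`), `dim X♯ = dim X′` (proper birational `π`) and
`dim X♯/G = dim X♯` (finite surjective `q♯`) feeding the bounds. [folklore] -/
theorem wildQuotientResolution_dimLE_of_phaseZero_of_pClosedWQ (d : WithBot ℕ∞)
    (hP0 : ∀ (p : ℕ) (_ : p.Prime) (k : Type) [Field k] [CharP k p] (X' X₁ : Scheme.{0})
      (f : X₁ ⟶ Spec (.of k)) (q : X' ⟶ X₁) (G : Type) [Group G] [Finite G] (ρ : G →* Aut X'),
      Function.Injective ρ → IsSeparated f → LocallyOfFiniteType f → QuasiCompact f →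
      IsIntegral X' → Scheme.IsRegular X' → IsFinite q → (∀ g : G, (ρ g).hom ≫ q = q) →
      topologicalKrullDim X' ≤ d →
      ∃ (Xs : Scheme.{0}) (π : Xs ⟶ X') (ρs : G →* Aut Xs), IsProper π ∧ IsBirational π ∧
        IsIntegral Xs ∧ Scheme.IsRegular Xs ∧ (∀ g : G, (ρs g).hom ≫ π = π ≫ (ρ g).hom) ∧
        (∀ x : Xs, HasNormalSylow p (inertiaSubgroup ρs x)) ∧
        ∀ x : Xs, ∃ U : Xs.Opens, IsAffineOpen U ∧ x ∈ U ∧ ∀ g : G, (ρs g).hom ⁻¹ᵁ U = U)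
    (hWQp : ∀ (p : ℕ) (_ : p.Prime) (k : Type) [Field k] [CharP k p] (X' X₁ : Scheme.{0})
      (f : X₁ ⟶ Spec (.of k)) (q : X' ⟶ X₁) (G : Type) [Group G] [Finite G] (ρ : G →* Aut X'),
      IsSeparated f → LocallyOfFiniteType f → QuasiCompact f → IsIntegral X₁ → IsIntegral X' →
      Scheme.IsRegular X' → IsFinite q → Function.Surjective q.base →
      (∃ U : X₁.Opens, Dense (U : Set X₁) ∧ Etale (q ∣_ U)) → (∀ g : G, (ρ g).hom ≫ q = q) →
      (∀ x y : X', q.base x = q.base y → ∃ g : G, (ρ g).hom.base x = y) →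
      (∀ x : X', HasNormalSylow p (inertiaSubgroup ρ x)) → topologicalKrullDim X₁ ≤ d →
      Scheme.HasResolution X₁)
    (p : ℕ) (hp : p.Prime) (k : Type) [Field k] [CharP k p] (X' X₁ : Scheme.{0})
    (f : X₁ ⟶ Spec (.of k)) (q : X' ⟶ X₁) (G : Type) [Group G] [Finite G] (ρ : G →* Aut X')
    (hsep : IsSeparated f) (hft : LocallyOfFiniteType f) (hqc : QuasiCompact f)
    (hX₁ : IsIntegral X₁) (hX' : IsIntegral X') (hreg : Scheme.IsRegular X') (hq : IsFinite q)
    (hsurj : Function.Surjective q.base)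
    (hU : ∃ U : X₁.Opens, Dense (U : Set X₁) ∧ Etale (q ∣_ U))
    (hρ : ∀ g : G, (ρ g).hom ≫ q = q)
    (horb : ∀ x y : X', q.base x = q.base y → ∃ g : G, (ρ g).hom.base x = y)
    (hdim : topologicalKrullDim X₁ ≤ d) : Scheme.HasResolution X₁ := by
  -- faithful WLOG: pass to `G ⧸ ker ρ`
  wlog hfaith : Function.Injective ρ generalizing G
  · refine this (G ⧸ ρ.ker) (QuotientGroup.kerLift ρ) (fun g => ?_) (fun x y hxy => ?_)
      (QuotientGroup.kerLift_injective ρ)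
    · induction g using QuotientGroup.induction_on with
      | H g => rw [QuotientGroup.kerLift_mk]; exact hρ g
    · obtain ⟨g, hg⟩ := horb x y hxy
      exact ⟨(g : G ⧸ ρ.ker), by rw [QuotientGroup.kerLift_mk]; exact hg⟩
  haveI := hsep; haveI := hft; haveI := hqc; haveI := hX'; haveI := hq; haveI := hX₁
  -- `dim X′ = dim X₁ ≤ d`
  haveI : Surjective q := ⟨hsurj⟩
  have hdimX' : topologicalKrullDim X' ≤ d :=
    (Literature.AlgebraicGeometry.Motives.Scheme.topologicalKrullDim_eq_of_isFinite_of_surjective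
      q).trans_le hdim
  obtain ⟨Xs, π, ρs, hπ, hbir, hXs, hXsreg, hequiv, hNpS, hcov⟩ :=
    hP0 p hp k X' X₁ f q G ρ hfaith hsep hft hqc hX' hreg hq hρ hdimX'
  haveI := hπ; haveI := hXs
  by_cases hdim0 : topologicalKrullDim X₁ ≤ 0
  · exact (Scheme.IsRegular.of_topologicalKrullDim_le_zero hdim0).hasResolution
  obtain ⟨Y₁, g, qs, r, hsep₁, hft₁, hqc₁, hY₁, hqsfin, hqssurj, hV, hinv₁, horb₁, hr, -, -, W, hWd,
      hWfin, hWet, hWbij⟩ :=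
    QuotientModel.stub_quotientModel p k X' X₁ f q G ρ hfaith hsurj hU hρ horb Xs π ρs hbir
      hequiv hcov
  haveI := hY₁; haveI := hr; haveI := hWfin; haveI := hWet; haveI := hqsfin
  -- `dim Y₁ = dim X♯ = dim X′ ≤ d`
  have hdimY₁ : topologicalKrullDim Y₁ ≤ d := by
    haveI : Surjective qs := ⟨hqssurj⟩
    rw [← Literature.AlgebraicGeometry.Motives.Scheme.topologicalKrullDim_eq_of_isFinite_of_surjective
      qs, topologicalKrullDim_eq_of_isBirational (q ≫ f) π hbir]
    exact hdimX'
  exact ComponentGluing.Scheme.HasResolution.of_isBirational r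
    (Birational.stub_birational_of_bijective k f r hdim0 W hWd hWbij)
    (hWQp p hp k Xs Y₁ g qs G ρs hsep₁ hft₁ hqc₁ hY₁ hXs hXsreg hqsfin hqssurj hV hinv₁ horb₁ hNpS
      hdimY₁)

end Summit.ResolutionOfSingularities.ResolutionOfSingularities.Theorems.WildQuotientResolution.GluedSplitDim

end
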